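import Summits.PneNP.PneNP.Theorems.ExpanderLinearGeneratorsResKRowImplied
import Summits.PneNP.PneNP.Theorems.ExpanderLinearGeneratorsExpandingCNF
import HarnessLib

/-!
# The `Res(k)` rung for expanding linear systems, XIII: every expanding CNF is hard for `Res(k)`

Support file for `stmt-PneNP-11443`. UNCONDITIONAL form of the session-9 calibration
`LinGen.expandingCNF_depthFregeHard_of_linearGeneratorDepthFregeHard` one level down the ladder:
for `1 ≤ k`, `8k ≤ 3ℓ`, `0 < δ`, `δ (k² + k + 2) < 2` there are `ε > 0` and `N` such that for
`n ≥ N`, for every family of clauses `C₀, …, C_{m-1}` over the variables `< n`, each with distinct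
variables, whose variable sets form an `(n^{1-δ}, 3ℓ/4)`-boundary expander, EVERY
`R(k)`-refutation of the CNF `[C₀, …, C_{m-1}]` has at least `2^{n^ε}` lines
(`expandingCNF_resK_lowerBound`). The CNF is row-implied (file XII) by the system of the parity
equations of its clauses (`LinGen.clause_eval_of_holds`), whose row supports are the variable sets
of the clauses, so the `Res(k)` rung for row-implied CNFs applies. Random `ℓ`-CNFs of linear size
are such families with high probability (next file).

[Alekhnovich 2011, Thm. 1.1 (random 3-CNF) and §3; Segerlind–Buss–Impagliazzo 2004, §6;
Chvátal–Szemerédi 1988]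
-/

namespace Summit.PneNP.PneNP.Theorems.ResKRestriction

open Finset Literature.Computability.Complexity Literature.Computability.MetaComplexity

variable {n : ℕ}

/-- **A CNF is row-implied by the system of parity equations of its clauses.**
[folklore; cf. `LinGen.clause_eval_of_holds`] -/
theorem rowImplied_ofFn {m : ℕ} {C : Fin m → Clause ℕ} {E : Fin m → LinEqMod 2 n}
    (he : ∀ i (j : Fin n), (E i).1 j = if (j : ℕ) ∈ (C i).map Prod.fst then 1 else 0)
    (hb : ∀ i, (E i).2 = ((C i).map fun l => if l.2 then (0 : ZMod 2) else 1).sum + 1)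
    (hc : ∀ i, ((C i).map Prod.fst).Nodup) (hcn : ∀ i, ∀ l ∈ C i, l.1 < n) :
    RowImplied E (List.ofFn C) := by
  intro C₀ hC₀
  obtain ⟨c, hcm, rfl⟩ := mem_clauseSet_iff.1 hC₀
  obtain ⟨i, rfl⟩ := List.mem_ofFn.1 hcm
  refine ⟨i, fun l hl => ?_, fun σ hσ => ?_⟩
  · rw [rowVars, LinGen.supp_map_of_clause (he i) (hcn i), List.mem_toFinset]
    exact List.mem_map.2 ⟨l, List.mem_toFinset.1 hl, rfl⟩
  · have hev := LinGen.clause_eval_of_holds (he i) (hc i) (hcn i) (hb i) σ hσ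
    rw [Clause.eval, List.any_eq_true] at hev
    obtain ⟨l, hl, e⟩ := hev
    exact ⟨l, List.mem_toFinset.2 hl, e⟩

/-- **Every CNF with boundary-expanding clause-variable sets is exponentially hard for `Res(k)`
(unconditional).** For `1 ≤ k`, `8k ≤ 3ℓ`, `0 < δ` and `δ (k² + k + 2) < 2` there are `ε > 0`
and `N` such that for `n ≥ N`: if `C₀, …, C_{m-1}` are clauses over the variables `< n`, each with
distinct variables, whose variable sets form an `(n^{1-δ}, 3ℓ/4)`-boundary expander, then every
`R(k)`-refutation of `[C₀, …, C_{m-1}]` has `≥ 2^{n^ε}` lines. (No unsatisfiability or width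
hypothesis: expansion at single clauses forces `≥ 3ℓ/4` variables per clause, and satisfiable CNFs
have no refutations.) [Alekhnovich 2011, Thm. 1.1–1.2; Segerlind–Buss–Impagliazzo 2004, §6]
[folklore] -/
theorem expandingCNF_resK_lowerBound (ℓ k : ℕ) (δ : ℝ) (hk : 1 ≤ k) (hkl : 8 * k ≤ 3 * ℓ)
    (hδ : 0 < δ) (hδk : δ * ((k : ℝ) ^ 2 + k + 2) < 2) :
    ∃ ε : ℝ, 0 < ε ∧ ∃ N : ℕ, ∀ n : ℕ, N ≤ n → ∀ (m : ℕ) (C : Fin m → Clause ℕ),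
      (∀ i, ((C i).map Prod.fst).Nodup) → (∀ i, ∀ l ∈ C i, l.1 < n) →
      IsBoundaryExpander (fun i => ((C i).map Prod.fst).toFinset) ((n : ℝ) ^ (1 - δ)) (3 / 4 * ℓ) →
      ∀ π : List (ResKLine ℕ), IsResKRefutation k (List.ofFn C) π →
        (2 : ℝ) ^ ((n : ℝ) ^ ε) ≤ (resKSize π : ℝ) := by
  obtain ⟨ε, hε, N, hN⟩ := resK_lowerBound_rowImplied ℓ k δ hk hkl hδ hδk
  refine ⟨ε, hε, N, fun n hn m C hc hcn hexp π hπ => ?_⟩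
  classical
  -- the system of clause equations
  set E : Fin m → LinEqMod 2 n := fun i =>
    (fun j => if (j : ℕ) ∈ (C i).map Prod.fst then 1 else 0,
      ((C i).map fun l => if l.2 then (0 : ZMod 2) else 1).sum + 1) with hE
  have he : ∀ i (j : Fin n), (E i).1 j = if (j : ℕ) ∈ (C i).map Prod.fst then 1 else 0 :=
    fun i j => rfl
  have hb : ∀ i, (E i).2 = ((C i).map fun l => if l.2 then (0 : ZMod 2) else 1).sum + 1 :=
    fun i => rfl
  have hexp' : IsBoundaryExpander (fun i => (E i).supp.map Fin.valEmbedding) ((n : ℝ) ^ (1 - δ))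
      (3 / 4 * ℓ) := by
    have : (fun i => (E i).supp.map Fin.valEmbedding) = fun i => ((C i).map Prod.fst).toFinset :=
      funext fun i => LinGen.supp_map_of_clause (he i) (hcn i)
    rw [this]
    exact hexp
  exact hN n hn m E hexp' (List.ofFn C) (rowImplied_ofFn he hb hc hcn) π hπ

end Summit.PneNP.PneNP.Theorems.ResKRestriction
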